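import Summits.Ventures.YMGap.Thresholds.StarFrontTorusSUN
import Summits.Ventures.YMGap.Thresholds.StarFrontLemmaG
import Literature.MathematicalPhysics.QuantumFieldTheory.Balaban1983to89.StrongCouplingKernelWindow
import HarnessLib

/-!
# Venture YMGap — track (c) «DS»: the generic-`N` star door in the crossover-ledger currency
# (`ExponentialClustering` / `StrongCouplingFront` of `SU(N)`, `d = 4`), from any one-link modulus

HONEST FRAMING: venture file (cell `pub-ymgap`), strong-coupling LATTICE bookkeeping for `SU(N)` lattice
Yang–Mills on the tori `(ℤ/L)^4`, Wilson plaquette weight `exp(−β (N − Re tr U_q))`, tree coupling `β ≥ 0`;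
nothing about the continuum, confinement at weak coupling, or the mass gap.  `SU(N)` twin of ds-1's
`StarFront` (typed for `SU(2)` and the schema `StarWindowBound`): the same Föllmer-smoothing route
(`StarFrontTorusSUN.star_abs_integral_mul_sub_le`), fed with the generic-`N` star window
`StarLemmaGSUN.star_window_of_oneLinkKRModulus`.  OUTPUT, for any one-link modulus `OneLinkKRModulus N R K`
(`K ≥ 0`, `R ≥ 6β₀/N`, `4Kβ₀/N ≤ 9/25`): `CrossoverLedger.StrongCouplingFront (fundamentalLatticeRep N) β₀` —
the SC-b currency of the tree's hypothesis-free all-`N` fronts `strongCouplingFront_SU` (`β₀ < N/48`) and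
`pub-balaban`'s `strongCouplingFront_SU_sixteenClass` (`β₀ < 500N/20223 = N/40.4…`).  With the Bakry–Émery
modulus `oneLinkKRModulus_SU` (hypothesis-free, `N ≥ 2`): `β₀ ≤ 9N/308 = N/34.2…`; `SU(3)` Wilson units:
`StrongCouplingFront (fundamentalLatticeRep 3) (β_W/3)` at every `0 ≤ β_W ≤ 81/308 = 0.2629…` (their
`4500/20223 = 0.2225…`).  Rates are the star rates `κ(ρ) = (1 − ρ)²/(2(16ρ + 1))`, `ρ = R_G(4Kβ₀/N)`.

Contents: `star_torusClustering`, `star_exponentialClustering_of_oneLinkKRModulus`,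
`star_strongCouplingFront_of_oneLinkKRModulus`, the Bakry–Émery rows `strongCouplingFront_SU_star`,
`su3_strongCouplingFront_le_star`.
-/

noncomputable section

open MeasureTheory ProbabilityTheory Function Finset
open Literature.Probability.LatticeModels
open Literature.Probability.LatticeModels.DobrushinMetric
open Literature.MathematicalPhysics.QuantumLattice (toTorusObservable IsCylinder IsLocalObservable
  LGConfig torusLift torusEdge groupHeatKernelMeasure fundamentalRep fundamentalLatticeRep)
open Literature.MathematicalPhysics.QuantumFieldTheory
open Literature.MathematicalPhysics.QuantumFieldTheory.Balaban1983to89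
open Literature.MathematicalPhysics.QuantumFieldTheory.Balaban1983to89.StrongCouplingTorusWindow
open Literature.MathematicalPhysics.QuantumFieldTheory.Balaban1983to89.StrongCouplingDobrushinWindow
  (OneLinkKRModulus)
open Literature.MathematicalPhysics.QuantumFieldTheory.Balaban1983to89.StrongCouplingKernelWindow
  (oneLinkKRModulus_SU)
open Summit.Ventures.YMGap.DSWindow
open Summit.Ventures.YMGap.StarWindowGauge (gaugeR Delta_pos gaugeR_lt_one_of_le)
open Summit.Ventures.YMGap.StarLemmaG (Karr)
open Summit.Ventures.YMGap.StarLemmaGSUN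

namespace Summit.Ventures.YMGap.StarSUNFront

variable {L : ℕ} [NeZero L] {N : ℕ}

/-! ### Volume-uniform clustering and the ledger currency, from a one-link modulus -/

/-- **Volume-uniform exponential clustering from star windows on all tori** (`SU(N)`, `d = 4`, tree
coupling `β`): if every torus of side `L ≥ 3` carries a vertex-indexed influence array for the star windows of
the `SU(N)` Wilson specification (nonnegative, supported within sup-distance `1` of the centre, (H1), per-star
received sums `≤ ρ`) with one `ρ < 1`, then for all bounded measurable local observables `F₁, F₂` of `ℤ⁴`
there is ONE constant `C` such that on every torus of side `L ≥ 3` and for every displacement with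
`2‖x‖_∞ < L`, `|⟨F₁ · (F₂ ∘ θ_x)⟩_L − ⟨F₁⟩_L ⟨F₂ ∘ θ_x⟩_L| ≤ C e^{−κ(ρ) ‖x‖_∞}` under the torus Wilson
measure (the Föllmer route of `su2Star_torusClustering`, `SU(2)` schema replaced by the four clauses).
[folklore] -/
theorem star_torusClustering (hN : 1 ≤ N) (β : ℝ) {ρ : ℝ} (hρ0 : 0 ≤ ρ) (hρ1 : ρ < 1)
    (hW : ∀ (L : ℕ) [NeZero L], 3 ≤ L → ∃ K : Site 4 L → Edge 4 L → Edge 4 L → ℝ,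
      (∀ s y x, 0 ≤ K s y x) ∧ (∀ s y x, K s y x ≠ 0 → ∀ w ∈ linkEnds y, torusNorm (s - w) ≤ 1) ∧
      IsLinkWindowContraction (d := 4) (L := L) (wilsonPlaqWeight N β) suFrobDist starWin (fun c => K c.1) ∧
      ∀ (s : Site 4 L) (x : Edge 4 L), x ∈ vertexStar s → ∑ y, K s y x ≤ ρ)
    (F₁ F₂ : LGConfig 4 (Matrix.specialUnitaryGroup (Fin N) ℂ) → ℝ)
    (h₁ : Literature.MathematicalPhysics.QuantumLattice.IsLocalObservable F₁)
    (h₂ : Literature.MathematicalPhysics.QuantumLattice.IsLocalObservable F₂) (h₁m : Measurable F₁)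
    (h₂m : Measurable F₂) (hb₁ : ∃ C, ∀ U, |F₁ U| ≤ C) (hb₂ : ∃ C, ∀ U, |F₂ U| ≤ C) :
    ∃ C : ℝ, ∀ (L : ℕ) [NeZero L], 3 ≤ L →
      ∀ x : Literature.Probability.LatticeModels.Site 4, 2 * ‖x‖ < (L : ℝ) →
      |(∫ V, toTorusObservable L (fun U => F₁ U * F₂ (Literature.MathematicalPhysics.QuantumLattice.configShift x U)) V
            ∂(wilsonMeasure (d := 4) (L := L) (fundamentalRep (Fin N)) β)) -
          (∫ V, toTorusObservable L F₁ V
            ∂(wilsonMeasure (d := 4) (L := L) (fundamentalRep (Fin N)) β)) *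
            ∫ V, toTorusObservable L (F₂ ∘ Literature.MathematicalPhysics.QuantumLattice.configShift x) V
              ∂(wilsonMeasure (d := 4) (L := L) (fundamentalRep (Fin N)) β)| ≤
        C * Real.exp (-(starRate ρ * ‖x‖)) := by
  classical
  obtain ⟨Λ₁, hΛ₁⟩ := h₁
  obtain ⟨Λ₂, hΛ₂⟩ := h₂
  obtain ⟨M₁, hM₁⟩ := hb₁
  obtain ⟨M₂, hM₂⟩ := hb₂
  have hN0 : (0 : ℝ) < N := by exact_mod_cast (show 0 < N by omega)
  have hκ0 : 0 < starRate ρ := starRate_pos hρ0 hρ1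
  have hM₁0 : 0 ≤ M₁ := (abs_nonneg _).trans (hM₁ fun _ => 1)
  have hM₂0 : 0 ≤ M₂ := (abs_nonneg _).trans (hM₂ fun _ => 1)
  have hE0 : 0 ≤ wilsonSmoothLip N 4 β := wilsonSmoothLip_nonneg hN 4 _
  -- the diameter of the two supports and the constant
  set D : ℕ := (Λ₁ ×ˢ Λ₂).sup fun ab =>
    Literature.Probability.LatticeModels.Site.supNorm (ab.1.1 - ab.2.1) with hDdef
  set K' : ℝ := Real.exp (starRate ρ * ((D + 4 : ℕ) : ℝ)) with hK'def
  have hK'0 : 0 < K' := Real.exp_pos _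
  have hK'1 : 1 ≤ K' := Real.one_le_exp (by positivity)
  set J : ℝ := ((1 + 4 * (2 * (4 - 1)) : ℕ) : ℝ) with hJdef
  have hJ0 : 0 ≤ J := by rw [hJdef]; exact Nat.cast_nonneg _
  set E : ℝ := wilsonSmoothLip N 4 β
  refine ⟨2 * M₁ * M₂ * K' + 4 * (2 * Real.sqrt N) ^ 2 * K' * ((Λ₁.card * J) * (M₁ * E)) *
    ((Λ₂.card * J) * (M₂ * E)), fun L _ hL x hx => ?_⟩
  have hL1 : 1 < L := by omega
  haveI : SecondCountableTopology (Matrix (Fin N) (Fin N) ℂ) :=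
    inferInstanceAs (SecondCountableTopology (Fin N → Fin N → ℂ))
  haveI : SecondCountableTopology (Matrix.specialUnitaryGroup (Fin N) ℂ) :=
    Topology.IsEmbedding.subtypeVal.secondCountableTopology
  -- the star window on this torus
  obtain ⟨Kw, hKarr, hKloc, hH1, hsum⟩ := hW L hL
  set μ := wilsonMeasure (d := 4) (L := L) (fundamentalRep (Fin N)) β with hμdef
  haveI : IsProbabilityMeasure μ := by
    have hG : IsGibbsMeasure (torusWeightSpec (d := 4) (L := L) (wilsonPlaqWeight N β)) μ := by
      rw [hμdef, wilsonMeasure_eq_groupHeatKernelMeasure β]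
      exact isGibbsMeasure_groupHeatKernelMeasure (continuous_wilsonPlaqWeight (N := N) _)
        (wilsonPlaqWeight_pos (N := N) _)
    exact hG.isProbabilityMeasure
  -- the observables on the torus of side `L`
  set f : GaugeConfig 4 L (Matrix.specialUnitaryGroup (Fin N) ℂ) → ℝ := toTorusObservable L F₁
  set g : GaugeConfig 4 L (Matrix.specialUnitaryGroup (Fin N) ℂ) → ℝ :=
    toTorusObservable L (F₂ ∘ Literature.MathematicalPhysics.QuantumLattice.configShift x)
  have hfm : Measurable f := h₁m.comp (measurable_torusLift L)
  have hgm : Measurable g :=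
    (h₂m.comp (Literature.MathematicalPhysics.QuantumLattice.configShift x).measurable).comp (measurable_torusLift L)
  have hfdep := dependsOn_toTorusObservable (G := Matrix.specialUnitaryGroup (Fin N) ℂ) L hΛ₁
  have hgdep := dependsOn_toTorusObservable_configShift
    (G := Matrix.specialUnitaryGroup (Fin N) ℂ) L hΛ₂ x
  have hMf : ∀ σ, |f σ| ≤ M₁ := fun σ => hM₁ _
  have hMg : ∀ σ, |g σ| ≤ M₂ := fun σ => hM₂ _
  rw [show (∫ V, toTorusObservable L (fun U => F₁ U * F₂ (Literature.MathematicalPhysics.QuantumLattice.configShift x U)) V ∂μ) =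
    ∫ V, f V * g V ∂μ from rfl]
  set Δf : Finset (Edge 4 L) := Λ₁.image (torusEdge L)
  set Δg : Finset (Edge 4 L) := Λ₂.image fun e => torusEdge L (e.1 - x, e.2) with hΔg
  have hfdep' : DependsOn f (↑Δf : Set (Edge 4 L)) := hfdep
  have hgdep' : DependsOn g (↑Δg : Set (Edge 4 L)) := hgdep
  have hxL : 2 * Literature.Probability.LatticeModels.Site.supNorm x < L := by
    rw [Literature.Probability.LatticeModels.Site.norm_eq_supNorm] at hx
    exact_mod_cast hx
  set nx : ℕ := Literature.Probability.LatticeModels.Site.supNorm x with hnx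
  have hnorm : ‖x‖ = (nx : ℝ) := Literature.Probability.LatticeModels.Site.norm_eq_supNorm x
  rw [hnorm]
  -- the trivial bound `|cov| ≤ 2 M₁ M₂`
  have htriv : |(∫ V, f V * g V ∂μ) - (∫ V, f V ∂μ) * ∫ V, g V ∂μ| ≤ 2 * M₁ * M₂ := by
    calc |(∫ V, f V * g V ∂μ) - (∫ V, f V ∂μ) * ∫ V, g V ∂μ|
        ≤ |∫ V, f V * g V ∂μ| + |(∫ V, f V ∂μ) * ∫ V, g V ∂μ| := abs_sub _ _
      _ ≤ M₁ * M₂ + M₁ * M₂ := by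
          refine add_le_add (abs_integral_le_of_abs_le (abs_mul_le_of_abs_le hMf hMg)) ?_
          rw [abs_mul]
          exact mul_le_mul (abs_integral_le_of_abs_le hMf) (abs_integral_le_of_abs_le hMg)
            (abs_nonneg _) hM₁0
      _ = 2 * M₁ * M₂ := by ring
  have hsecond0 : 0 ≤ 4 * (2 * Real.sqrt N) ^ 2 * K' * ((Λ₁.card * J) * (M₁ * E)) *
      ((Λ₂.card * J) * (M₂ * E)) := by positivity
  by_cases hnear : nx < D + 4
  · -- NEAR: `K' e^{-κ ‖x‖} ≥ 1`
    have hone : 1 ≤ K' * Real.exp (-(starRate ρ * nx)) := by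
      rw [hK'def, ← Real.exp_add]
      refine Real.one_le_exp ?_
      have : (nx : ℝ) ≤ ((D + 4 : ℕ) : ℝ) := by exact_mod_cast hnear.le
      nlinarith
    refine htriv.trans ?_
    calc 2 * M₁ * M₂ ≤ 2 * M₁ * M₂ * (K' * Real.exp (-(starRate ρ * nx))) :=
          le_mul_of_one_le_right (by positivity) hone
      _ ≤ (2 * M₁ * M₂ * K' + 4 * (2 * Real.sqrt N) ^ 2 * K' * ((Λ₁.card * J) * (M₁ * E)) *
            ((Λ₂.card * J) * (M₂ * E))) * Real.exp (-(starRate ρ * nx)) := by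
          rw [add_mul]
          exact le_add_of_le_of_nonneg (le_of_eq (by ring)) (by positivity)
  -- FAR: `D + 4 ≤ ‖x‖_∞`; the plaquette closure of `Δf` misses `Δg`
  rw [not_lt] at hnear
  have hgeom : ∀ a ∈ Λ₁, ∀ b ∈ Λ₂,
      nx ≤ torusNorm ((torusEdge L a).1 - (torusEdge L (b.1 - x, b.2)).1) + D := by
    intro a ha b hb
    have hs := supNorm_le_torusNorm_add (L := L) (a := a.1) (b := b.1) hxL
    have hDab : Literature.Probability.LatticeModels.Site.supNorm (a.1 - b.1) ≤ D := by
      rw [hDdef]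
      exact Finset.le_sup (f := fun ab : Literature.MathematicalPhysics.QuantumLattice.ZdEdge 4 ×
          Literature.MathematicalPhysics.QuantumLattice.ZdEdge 4 =>
        Literature.Probability.LatticeModels.Site.supNorm (ab.1.1 - ab.2.1))
        (Finset.mk_mem_product ha hb)
    exact hs.trans (Nat.add_le_add_left hDab _)
  have hsep : ∀ y ∈ plaqClosure Δf, y ∉ Δg := by
    intro y hy hyg
    obtain ⟨y₀, hy₀, hyy₀⟩ := exists_near_of_mem_plaqClosure hy
    obtain ⟨a, ha, rfl⟩ := Finset.mem_image.1 hy₀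
    obtain ⟨b, hb, rfl⟩ := Finset.mem_image.1 hyg
    have h1 : torusNorm ((torusEdge L a).1 - (torusEdge L (b.1 - x, b.2)).1) ≤ 1 := by
      rw [← torusNorm_neg, neg_sub]; exact hyy₀
    have h2 := hgeom a ha b hb
    omega
  by_cases hΛ₂e : Λ₂ = ∅
  · -- `F₂` is constant on the torus: the covariance vanishes
    have hΔg0 : Δg = ∅ := by rw [hΔg, hΛ₂e, Finset.image_empty]
    set V₁ : GaugeConfig 4 L (Matrix.specialUnitaryGroup (Fin N) ℂ) := fun _ => 1
    have hgc : ∀ V, g V = g V₁ := fun V => hgdep' fun i hi => by simp [hΔg0] at hi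
    have hI1 : ∫ V, f V * g V ∂μ = (∫ V, f V ∂μ) * g V₁ := by
      rw [← integral_mul_const]
      exact integral_congr_ae (ae_of_all _ fun V => by simp only [hgc V])
    have hI2 : ∫ V, g V ∂μ = g V₁ := by
      have h := integral_congr_ae (μ := μ) (ae_of_all μ fun V => hgc V)
      rw [integral_const, smul_eq_mul, probReal_univ, one_mul] at h
      exact h
    have hI : (∫ V, f V * g V ∂μ) - (∫ V, f V ∂μ) * ∫ V, g V ∂μ = 0 := by rw [hI1, hI2, sub_self]
    rw [hI, abs_zero]
    positivity
  -- the endpoint distance between the two plaquette closures is `≥ ‖x‖_∞ − D − 4`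
  have hL₀ : ∀ y ∈ plaqClosure Δf, ∀ z ∈ plaqClosure Δg, ∀ a ∈ linkEnds y, ∀ w ∈ linkEnds z,
      nx - (D + 4) ≤ torusNorm (a - w) := by
    intro y hy z hz a ha w hw
    obtain ⟨y₀, hy₀, hyy₀⟩ := exists_near_of_mem_plaqClosure hy
    obtain ⟨a₀, ha₀, rfl⟩ := Finset.mem_image.1 hy₀
    obtain ⟨z₀, hz₀, hzz₀⟩ := exists_near_of_mem_plaqClosure hz
    obtain ⟨b₀, hb₀, rfl⟩ := Finset.mem_image.1 hz₀
    have h2 := hgeom a₀ ha₀ b₀ hb₀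
    have htri : torusNorm ((torusEdge L a₀).1 - (torusEdge L (b₀.1 - x, b₀.2)).1) ≤
        1 + 1 + torusNorm (a - w) + 1 + 1 := by
      calc torusNorm ((torusEdge L a₀).1 - (torusEdge L (b₀.1 - x, b₀.2)).1)
          ≤ torusNorm ((torusEdge L a₀).1 - y.1) + torusNorm (y.1 - (torusEdge L (b₀.1 - x, b₀.2)).1) :=
            torusNorm_sub_le _ _ _
        _ ≤ torusNorm ((torusEdge L a₀).1 - y.1) + (torusNorm (y.1 - a) +
            torusNorm (a - (torusEdge L (b₀.1 - x, b₀.2)).1)) :=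
            Nat.add_le_add_left (torusNorm_sub_le _ _ _) _
        _ ≤ torusNorm ((torusEdge L a₀).1 - y.1) + (torusNorm (y.1 - a) +
            (torusNorm (a - w) + torusNorm (w - (torusEdge L (b₀.1 - x, b₀.2)).1))) :=
            Nat.add_le_add_left (Nat.add_le_add_left (torusNorm_sub_le _ _ _) _) _
        _ ≤ torusNorm ((torusEdge L a₀).1 - y.1) + (torusNorm (y.1 - a) +
            (torusNorm (a - w) + (torusNorm (w - z.1) + torusNorm (z.1 - (torusEdge L (b₀.1 - x, b₀.2)).1)))) :=
            Nat.add_le_add_left (Nat.add_le_add_left (Nat.add_le_add_left (torusNorm_sub_le _ _ _) _) _) _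
        _ ≤ 1 + (1 + (torusNorm (a - w) + (1 + 1))) := by
            refine Nat.add_le_add ?_ (Nat.add_le_add (torusNorm_fst_sub_linkEnds_le_one y ha)
              (Nat.add_le_add_left (Nat.add_le_add ?_ hzz₀) _))
            · rw [← torusNorm_neg, neg_sub]; exact hyy₀
            · rw [← torusNorm_neg, neg_sub]; exact torusNorm_fst_sub_linkEnds_le_one z hw
        _ = 1 + 1 + torusNorm (a - w) + 1 + 1 := by ring
    omega
  have key := star_abs_integral_mul_sub_le hL1 hN β hρ0 hρ1 hKarr hKloc hH1 hsum hfm hfdep' hMf hgm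
    hgdep' hMg hsep (nx - (D + 4)) hL₀
  refine key.trans ?_
  -- `e^{-κ L₀} ≤ K' e^{-κ ‖x‖}`
  have hexp : Real.exp (-(starRate ρ * ((nx - (D + 4) : ℕ) : ℝ))) ≤
      K' * Real.exp (-(starRate ρ * nx)) := by
    rw [hK'def, ← Real.exp_add]
    refine Real.exp_le_exp.2 ?_
    have : ((nx - (D + 4) : ℕ) : ℝ) = (nx : ℝ) - ((D + 4 : ℕ) : ℝ) := by
      rw [Nat.cast_sub hnear]
    rw [this]
    nlinarith
  have hcardf : ((plaqClosure Δf).card : ℝ) ≤ Λ₁.card * J := by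
    have h1 : ((plaqClosure Δf).card : ℝ) ≤ Δf.card * J := by
      rw [hJdef]; exact_mod_cast card_plaqClosure_le Δf
    have h2 : (Δf.card : ℝ) ≤ Λ₁.card := by exact_mod_cast Finset.card_image_le
    exact h1.trans (mul_le_mul_of_nonneg_right h2 hJ0)
  have hcardg : ((plaqClosure Δg).card : ℝ) ≤ Λ₂.card * J := by
    have h1 : ((plaqClosure Δg).card : ℝ) ≤ Δg.card * J := by
      rw [hJdef]; exact_mod_cast card_plaqClosure_le Δg
    have h2 : (Δg.card : ℝ) ≤ Λ₂.card := by exact_mod_cast Finset.card_image_le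
    exact h1.trans (mul_le_mul_of_nonneg_right h2 hJ0)
  calc 4 * (2 * Real.sqrt N) ^ 2 * Real.exp (-(starRate ρ * ((nx - (D + 4) : ℕ) : ℝ))) *
        ((plaqClosure Δf).card * (M₁ * E)) * ((plaqClosure Δg).card * (M₂ * E))
      ≤ 4 * (2 * Real.sqrt N) ^ 2 * (K' * Real.exp (-(starRate ρ * nx))) *
        ((Λ₁.card * J) * (M₁ * E)) * ((Λ₂.card * J) * (M₂ * E)) := by
        gcongr
    _ = (4 * (2 * Real.sqrt N) ^ 2 * K' * ((Λ₁.card * J) * (M₁ * E)) * ((Λ₂.card * J) * (M₂ * E))) *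
          Real.exp (-(starRate ρ * nx)) := by ring
    _ ≤ (2 * M₁ * M₂ * K' + 4 * (2 * Real.sqrt N) ^ 2 * K' * ((Λ₁.card * J) * (M₁ * E)) *
          ((Λ₂.card * J) * (M₂ * E))) * Real.exp (-(starRate ρ * nx)) := by
        rw [add_mul]
        exact le_add_of_nonneg_left (by positivity)

/-- **The crossover-ledger clustering currency from a one-link modulus** (`SU(N)`, `d = 4`, tree coupling
`β`): `OneLinkKRModulus N R K` (`K ≥ 0`, `R ≥ 6|β|/N`), `4K|β|/N < 2/3` and `R_G(4K|β|/N) ≤ ρ < 1` give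
`CrossoverLedger.ExponentialClustering (fundamentalRep (Fin N)) β (κ(ρ))`, `κ(ρ) = (1 − ρ)²/(2(16ρ + 1))`
(odd tori of side `2S+1 ≥ 3`; translation invariance of the torus Wilson state identifies `⟨B ∘ θ⟩ = ⟨B⟩`,
as in `su2Star_exponentialClustering`). [folklore] -/
theorem star_exponentialClustering_of_oneLinkKRModulus (hN : 1 ≤ N) {β R K : ℝ} (hK0 : 0 ≤ K)
    (hR : |β| / N * 6 ≤ R) (hmod : OneLinkKRModulus N R K) {ρ : ℝ}
    (hc : 4 * (K * (|β| / N)) < 2 / 3) (hρ : gaugeR (4 * (K * (|β| / N))) ≤ ρ) (hρ1 : ρ < 1) :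
    CrossoverLedger.ExponentialClustering (G := Matrix.specialUnitaryGroup (Fin N) ℂ)
      (fundamentalRep (Fin N)) β (starRate ρ) := by
  have hN0 : (0 : ℝ) < N := by exact_mod_cast (show 0 < N by omega)
  have hc0 : 0 ≤ K * (|β| / N) := mul_nonneg hK0 (by positivity)
  have hρ0 : 0 ≤ ρ := (gaugeR_coef_nonneg hc0 (by linarith)).trans hρ
  have hc6 : K * (|β| / N) < 1 / 6 := by linarith
  refine ⟨starRate_pos hρ0 hρ1, fun A B => ?_⟩
  obtain ⟨C, hC⟩ := star_torusClustering hN β hρ0 hρ1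
    (fun L _ hL => by
      obtain ⟨hK, hKloc, hH1, hH2⟩ := star_window_of_oneLinkKRModulus (L := L) hL hN hK0 hR hmod hc6
      exact ⟨_, hK, hKloc, hH1, fun s x hx => (hH2 s x hx).le.trans hρ⟩)
    A.F B.F ⟨A.supp, A.isCylinder⟩ ⟨B.supp, B.isCylinder⟩ A.measurable B.measurable A.bounded B.bounded
  refine ⟨C, 1, fun S hS₀ n hn => ?_⟩
  have hL3 : 3 ≤ 2 * S + 1 := by omega
  set x : Literature.Probability.LatticeModels.Site 4 := -Pi.single (0 : Fin 4) (n : ℤ)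
  have hxn : ‖x‖ = n := norm_neg_single_natCast n
  have hx2 : 2 * ‖x‖ < ((2 * S + 1 : ℕ) : ℝ) := by
    rw [hxn]; push_cast
    have : (n : ℝ) ≤ S := by exact_mod_cast hn
    linarith
  have h := hC (2 * S + 1) hL3 x hx2
  rw [hxn] at h
  -- translation invariance: `⟨B ∘ θ_x⟩ = ⟨B⟩`
  have htrans : ∫ V, toTorusObservable (2 * S + 1) (B.F ∘ Literature.MathematicalPhysics.QuantumLattice.configShift x) V
      ∂(wilsonMeasure (d := 4) (L := 2 * S + 1) (fundamentalRep (Fin N)) β) =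
      ∫ V, toTorusObservable (2 * S + 1) B.F V
        ∂(wilsonMeasure (d := 4) (L := 2 * S + 1) (fundamentalRep (Fin N)) β) := by
    rw [toTorusObservable_comp_configShift]
    simp only [Function.comp_apply]
    rw [← integral_map_equiv, wilsonMeasure_map_torusConfigShift]
  rw [htrans] at h
  exact h

/-- **The strong-coupling front of the crossover ledger from a one-link modulus** (`SU(N)`, `d = 4`, tree
units): `OneLinkKRModulus N R K` with `K ≥ 0` on the tilt ball `R ≥ 6β₀/N`, `0 ≤ β₀`, `4Kβ₀/N ≤ 9/25` gives
`CrossoverLedger.StrongCouplingFront (fundamentalLatticeRep N) β₀` with the single rate `κ(R_G(4Kβ₀/N))`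
(for `β ≤ β₀` the received sum `R_G(4Kβ/N)` is `≤ R_G(4Kβ₀/N)` by `gaugeR_mono`) — the SAME currency as
the tree's all-`N` fronts `strongCouplingFront_SU` (`β₀ < N/48`) and `strongCouplingFront_SU_sixteenClass`
(`β₀ < 500N/20223`). [folklore] -/
theorem star_strongCouplingFront_of_oneLinkKRModulus (hN : 1 ≤ N) {β₀ R K : ℝ} (h0 : 0 ≤ β₀) (hK0 : 0 ≤ K)
    (hR : β₀ / N * 6 ≤ R) (hmod : OneLinkKRModulus N R K) (h : 4 * (K * (β₀ / N)) ≤ 9 / 25) :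
    CrossoverLedger.StrongCouplingFront (fundamentalLatticeRep N) β₀ := by
  have hN0 : (0 : ℝ) < N := by exact_mod_cast (show 0 < N by omega)
  have hc0 : 0 ≤ K * (β₀ / N) := mul_nonneg hK0 (div_nonneg h0 hN0.le)
  have hρ0 : 0 ≤ gaugeR (4 * (K * (β₀ / N))) := gaugeR_coef_nonneg hc0 (by linarith)
  have hρ1 : gaugeR (4 * (K * (β₀ / N))) < 1 := gaugeR_lt_one_of_le (by linarith) h
  refine ⟨starRate (gaugeR (4 * (K * (β₀ / N)))), starRate_pos hρ0 hρ1, fun β hβ0 hββ₀ => ?_⟩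
  have hβN : |β| / N ≤ β₀ / N := by
    rw [abs_of_nonneg hβ0]; exact div_le_div_of_nonneg_right hββ₀ hN0.le
  have hcβ : K * (|β| / N) ≤ K * (β₀ / N) := mul_le_mul_of_nonneg_left hβN hK0
  have hcβ0 : 0 ≤ K * (|β| / N) := mul_nonneg hK0 (by positivity)
  exact star_exponentialClustering_of_oneLinkKRModulus hN hK0 (by linarith) hmod (by linarith)
    (gaugeR_mono (by linarith) (by linarith) (by linarith)) hρ1

/-! ### Hypothesis-free rows (Bakry–Émery modulus), every `N ≥ 2`; `SU(3)` in Wilson units -/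

omit [NeZero L] in
/-- **THE STRONG-COUPLING FRONT FOR EVERY `SU(N)`, `N ≥ 2`, `d = 4`, HYPOTHESIS-FREE, below `β₀ = 9N/308`**
(tree units; 't Hooft `β₀/N ≤ 9/308 = 0.02922…`, DERIVED here): `StrongCouplingFront (fundamentalLatticeRep N) β₀`
— the generic-`N` star door with the Bakry–Émery modulus `oneLinkKRModulus_SU` (`K = 1/(1/2 − 6β₀/N)`).
For comparison, in the SAME currency (SC-b) and class (K, hypothesis-free): the tree's `strongCouplingFront_SU`
(`β₀ < N/48`, the printed Shen–Zhu–Zhu window) and `pub-balaban`'s `strongCouplingFront_SU_sixteenClass`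
(`β₀ < 500N/20223 = N/40.45`); `(9/308)/(500/20223) = 1.18…`. [folklore] -/
theorem strongCouplingFront_SU_star (hN : 2 ≤ N) {β₀ : ℝ} (h0 : 0 ≤ β₀) (h : β₀ / N ≤ 9 / 308) :
    CrossoverLedger.StrongCouplingFront (fundamentalLatticeRep N) β₀ := by
  have hN0 : (0 : ℝ) < N := by exact_mod_cast (show 0 < N by omega)
  have hx0 : 0 ≤ β₀ / N := div_nonneg h0 hN0.le
  have h1 : β₀ / N * 6 < 1 / 2 := by linarith
  have hpos : 0 < 1 / 2 - β₀ / N * 6 := by linarith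
  have hK0 : 0 ≤ 1 / (1 / 2 - β₀ / N * 6) := (one_div_pos.2 hpos).le
  have h4 : 4 * (1 / (1 / 2 - β₀ / N * 6) * (β₀ / N)) ≤ 9 / 25 := by
    rw [show 4 * (1 / (1 / 2 - β₀ / N * 6) * (β₀ / N)) = (4 * (β₀ / N)) / (1 / 2 - β₀ / N * 6) by ring,
      div_le_iff₀ hpos]
    linarith
  exact star_strongCouplingFront_of_oneLinkKRModulus (by omega) h0 hK0 le_rfl (oneLinkKRModulus_SU hN h1) h4

omit [NeZero L] in
/-- **`SU(3)`: the strong-coupling front at every `0 ≤ β_W ≤ 81/308 = 0.2629…`, hypothesis-free** (Wilson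
`β_W = 6/g²`, tree coupling `β_W/3`): `StrongCouplingFront (fundamentalLatticeRep 3) (β_W/3)` — DERIVED here;
same currency and class as `pub-balaban`'s `su3_strongCouplingFront_lt` (`β_W < 4500/20223 = 0.2225…`) and the
printed-window row `3/16`. [folklore] -/
theorem su3_strongCouplingFront_le_star {βW : ℝ} (h0 : 0 ≤ βW) (h : βW ≤ 81 / 308) :
    CrossoverLedger.StrongCouplingFront (fundamentalLatticeRep 3) (βW / 3) :=
  strongCouplingFront_SU_star (N := 3) (by norm_num) (by positivity) (by push_cast; linarith)

omit [NeZero L] in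
/-- The front numbers side by side ('t Hooft units): `1/48 < 500/20223 < 9/308`, and in `SU(3)` Wilson units
`3/16 < 4500/20223 < 81/308`. [folklore] -/
theorem front_numbers :
    (1 : ℝ) / 48 < 500 / 20223 ∧ (500 : ℝ) / 20223 < 9 / 308 ∧
      (3 : ℝ) / 16 < 4500 / 20223 ∧ (4500 : ℝ) / 20223 < 81 / 308 := by
  norm_num

end Summit.Ventures.YMGap.StarSUNFront

end
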